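import Literature.Probability.RandomPlanarGeometry.LoewnerScaling
import Literature.Probability.RandomPlanarGeometry.LoewnerInverseCocycle
import HarnessLib

/-!
# The backward (reverse-time) chordal Loewner flow of a point

Trunk T-STOCH. Deterministic calculus for the **backward Loewner flow** used in Rohde–Schramm's
derivative estimates (S. Rohde, O. Schramm, *Basic properties of SLE*, Ann. Math. 161 (2005), §3):
for a continuous driving function `U : ℝ≥0 → ℝ` and `w ∈ ℍ` the backward flow `hₜ(w)` solves

  `∂ₜ hₜ(w) = -2 / (hₜ(w) - U t)`, `h₀(w) = w`,

for *all* `t ≥ 0` (the imaginary part increases, so nothing is swallowed). We **define**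
`Loewner.bwdFlow U w t := fₜ^{U(t-·)}(w)`, the inverse Loewner map at time `t` of the time-reversed
driving function `Loewner.revDriver U t = U (t - ·)` (Rohde–Schramm's Lemma 3.1 in its pathwise
form: `gₜ⁻¹` of a driver read backwards is the backward flow), and prove:

* `bwdFlow_eq_bwd` — on `[0, T]` the trajectory `t ↦ hₜ(w)` is the tree's backward solution
  `Loewner.bwd (revDriver U T) T w` (by the inverse cocycle `loewnerInv_add`), hence it solves the
  backward equation (`hasDerivAt_bwdFlow`, `hasDerivWithinAt_bwdFlow_zero`), is continuous, and
  `im hₜ(w) ≥ im w`;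
* the integrated equations for `Zₜ = Xₜ + i Yₜ := hₜ(w) - U t`:
  `re hₜ = re w - ∫₀ᵗ 2 Xₛ/|Zₛ|² ds`, `Yₜ = im w + ∫₀ᵗ 2 Yₛ/|Zₛ|² ds`,
  `log Yₜ = log (im w) + ∫₀ᵗ 2/|Zₛ|² ds`, `Yₜ² ≤ (im w)² + 4t`;
* the derivative in the starting point: `w ↦ hₜ(w)` is holomorphic with
  `hₜ'(w) = exp ∫₀ᵗ 2/Zₛ² ds` (`hasDerivAt_bwdFlow_start`, a sharpening of the tree's
  `hasDerivAt_invFunOn_map` which only asserted *some* non-zero derivative), so that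
  `|hₜ'(w)| = exp ∫₀ᵗ 2 (Xₛ² - Yₛ²)/|Zₛ|⁴ ds`, Rohde–Schramm's (3.9)
  `∂ₜ log |hₜ'| = 2 Re (Zₜ⁻²)` for the backward flow;
* consequences used in Cor. 3.5: `(im w / Yₜ) |hₜ'(w)| = exp (-∫₀ᵗ 4Yₛ²/|Zₛ|⁴ ds) ≤ 1` (the
  quantity `ψ` of Thm. 3.2), `|hₜ'(w)| ≤ Yₜ / im w` (the "Schwarz lemma" step), and
  `|log |hₜ'| - log |hₛ'|| ≤ log Yₜ - log Yₛ` for `s ≤ t` ("`|∂ᵤ log |g'|| ≤ 1`", eq. (3.10)).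

Everything is pathwise and sorry-free; Mathlib has no Loewner chains.

## References

* S. Rohde, O. Schramm, *Basic properties of SLE*, Ann. of Math. 161 (2005), §2.1, Lemma 3.1,
  eqs. (3.8)–(3.10), Thm. 3.2, Cor. 3.5.
* G. F. Lawler, *Conformally Invariant Processes in the Plane*, AMS (2005), Ch. 4 §4.1, Rem. 4.8,
  eq. (4.7).
-/

noncomputable section

open Set Filter Topology Metric Complex intervalIntegral
open UpperHalfPlane (upperHalfPlaneSet isOpen_upperHalfPlaneSet)
open scoped NNReal

namespace Literature.Probability.RandomPlanarGeometry

namespace Loewner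

variable {U : ℝ≥0 → ℝ} {w : ℂ}

/-! ### The time-reversed driving function -/

/-- The driving function read backwards from time `t`: `revDriver U t s = U (t - s)` (truncated
subtraction, so it is frozen at `U 0` after time `t`). Rohde–Schramm (2005), proof of Lemma 3.1
(`ξ̂_{t₁}(t) = ξ(t₁ + t) - ξ(t₁)` with `t ≤ 0`). [cite: RohdeSchramm2005, Lemma 3.1] -/
def revDriver (U : ℝ≥0 → ℝ) (t : ℝ≥0) : ℝ≥0 → ℝ := fun s ↦ U (t - s)

/-- Unfolding lemma for `revDriver`. [folklore] -/
@[simp] theorem revDriver_apply (U : ℝ≥0 → ℝ) (t s : ℝ≥0) : revDriver U t s = U (t - s) := rfl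

/-- The reversed driving function is continuous. [folklore] -/
theorem continuous_revDriver (hU : Continuous U) (t : ℝ≥0) : Continuous (revDriver U t) :=
  hU.comp (continuous_const.sub continuous_id)

/-- Reversing twice: `revDriver U t (t - s) = U s` for `s ≤ t`. [folklore] -/
theorem revDriver_tsub (U : ℝ≥0 → ℝ) {s t : ℝ≥0} (h : s ≤ t) : revDriver U t (t - s) = U s := by
  rw [revDriver_apply, tsub_tsub_cancel_of_le h]

/-- At time `0` of the reversed clock one reads `U t`. [folklore] -/
@[simp] theorem revDriver_zero (U : ℝ≥0 → ℝ) (t : ℝ≥0) : revDriver U t 0 = U t := by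
  simp [revDriver]

/-- Shifting the reversed driver: `revDriver U T ((T - u) + ·) = revDriver U u` for `u ≤ T`.
[folklore] -/
theorem revDriver_shift (U : ℝ≥0 → ℝ) {u T : ℝ≥0} (hu : u ≤ T) :
    (fun s ↦ revDriver U T (T - u + s)) = revDriver U u := by
  funext s
  simp only [revDriver_apply]
  rw [tsub_add_eq_tsub_tsub, tsub_tsub_cancel_of_le hu]

/-! ### The backward flow -/

/-- The **backward Loewner flow** of `w` driven by `U`, at time `t`: `hₜ(w) := fₜ^{U(t-·)}(w)`, the
inverse Loewner map at time `t` (`Loewner.loewnerInv`) of the reversed driving function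
`revDriver U t`. For continuous `U` and `w ∈ ℍ` it is the solution of
`∂ₜ hₜ(w) = -2/(hₜ(w) - U t)`, `h₀(w) = w` (`hasDerivAt_bwdPath`); junk (from `Function.invFunOn`)
off `ℍ`. Rohde–Schramm (2005), §3.1 (the flow `g₋ₜ`, `t > 0`) and Lemma 3.1; Lawler (2005),
Rem. 4.8. [cite: RohdeSchramm2005, Lemma 3.1] -/
def bwdFlow (U : ℝ≥0 → ℝ) (w : ℂ) (t : ℝ≥0) : ℂ :=
  loewnerInv (revDriver U t) t w

/-- Unfolding lemma for `bwdFlow`. [folklore] -/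
theorem bwdFlow_apply (U : ℝ≥0 → ℝ) (w : ℂ) (t : ℝ≥0) :
    bwdFlow U w t = loewnerInv (revDriver U t) t w := rfl

/-- The backward flow starts at `w` (`f₀ = id` on `ℍ`). [folklore] -/
theorem bwdFlow_zero (hU : Continuous U) (hw : 0 < w.im) : bwdFlow U w 0 = w := by
  have hV : Continuous (revDriver U 0) := continuous_revDriver hU 0
  have hne : w ≠ revDriver U 0 0 := ne_driving_of_im_pos hw 0
  have hdom : w ∈ domain (revDriver U 0) 0 := by
    rw [mem_domain_iff]
    refine ⟨hw, ?_⟩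
    rw [WithTop.coe_zero]
    exact swallowingTime_pos_holds hV hne
  have h1 : map (revDriver U 0) 0 w = w := map_zero_apply hV hne
  have h2 := loewnerInv_map hV hdom
  rw [h1] at h2
  exact h2

/-- Along the backward flow the imaginary part stays `≥ im w`. [folklore] -/
theorem im_le_im_bwdFlow (hU : Continuous U) (hw : 0 < w.im) (t : ℝ≥0) :
    w.im ≤ (bwdFlow U w t).im :=
  im_le_im_loewnerInv (continuous_revDriver hU t) t hw

/-- The backward flow of a point of `ℍ` stays in `ℍ`. [folklore] -/
theorem im_bwdFlow_pos (hU : Continuous U) (hw : 0 < w.im) (t : ℝ≥0) : 0 < (bwdFlow U w t).im :=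
  hw.trans_le (im_le_im_bwdFlow hU hw t)

/-- **The backward flow is the tree's backward solution** on every horizon `[0, T]`:
`hᵤ(w) = bwd (revDriver U T) T w u` for `u ≤ T` — by the inverse cocycle
`f_T = f_{T-u} ∘ f^{W((T-u)+·)}_u` (`loewnerInv_add`) for `W = revDriver U T`, whose shifted
driver `W((T-u)+·)` is `revDriver U u`. Rohde–Schramm (2005), proof of Lemma 3.1.
[cite: RohdeSchramm2005, Lemma 3.1] -/
theorem bwdFlow_eq_bwd (hU : Continuous U) (hw : 0 < w.im) {u T : ℝ≥0} (hu : u ≤ T) :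
    bwdFlow U w u = bwd (revDriver U T) T w u := by
  set W := revDriver U T with hW
  have hWc : Continuous W := continuous_revDriver hU T
  have hcoc : loewnerInv W T w = loewnerInv W (T - u) (bwdFlow U w u) := by
    have h1 : loewnerInv W T w = loewnerInv W (T - u + u) w := by rw [tsub_add_cancel_of_le hu]
    rw [h1, loewnerInv_add hWc (T - u) u hw, hW, revDriver_shift U hu]
    rfl
  have hsub : (((T : ℝ) - u).toNNReal : ℝ≥0) = T - u := by
    rw [← NNReal.coe_sub hu, Real.toNNReal_coe]
  change bwdFlow U w u = map W (((T : ℝ) - u).toNNReal) (loewnerInv W T w)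
  rw [hsub, hcoc, map_loewnerInv hWc (T - u) (im_bwdFlow_pos hU hw u)]

/-! ### The trajectory as a function of real time and the backward equation -/

/-- The backward trajectory of `w` as a function of real time (real `r` read in `ℝ≥0` through
`Real.toNNReal`, so it is frozen at `w` for `r ≤ 0`). [folklore] -/
def bwdPath (U : ℝ≥0 → ℝ) (w : ℂ) : ℝ → ℂ := fun r ↦ bwdFlow U w r.toNNReal

/-- Unfolding lemma for `bwdPath`. [folklore] -/
theorem bwdPath_apply (U : ℝ≥0 → ℝ) (w : ℂ) (r : ℝ) : bwdPath U w r = bwdFlow U w r.toNNReal := rfl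

/-- `bwdPath` at a time of `ℝ≥0`. [folklore] -/
@[simp] theorem bwdPath_coe (U : ℝ≥0 → ℝ) (w : ℂ) (t : ℝ≥0) : bwdPath U w t = bwdFlow U w t := by
  rw [bwdPath_apply, Real.toNNReal_coe]

/-- On `[0, T]` the backward trajectory is `bwd (revDriver U T) T w`. [folklore] -/
theorem eqOn_bwdPath_bwd (hU : Continuous U) (hw : 0 < w.im) (T : ℝ≥0) :
    EqOn (bwdPath U w) (bwd (revDriver U T) T w) (Icc (0 : ℝ) T) := by
  intro r hr
  have hr' : r.toNNReal ≤ T := Real.toNNReal_le_iff_le_coe.2 hr.2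
  rw [bwdPath_apply, bwdFlow_eq_bwd hU hw hr', Real.coe_toNNReal _ hr.1]

/-- The backward vector field along the trajectory, read through the reversed driver: for
`0 ≤ r ≤ T`, `-V^{revDriver U T}(T - r, x) = -2/(x - U r)`. [folklore] -/
theorem neg_vectorField_revDriver {T : ℝ≥0} {r : ℝ} (hr : r ∈ Icc (0 : ℝ) T) (x : ℂ) :
    -vectorField (revDriver U T) ((T : ℝ) - r) x = -2 / (x - U r.toNNReal) := by
  have hr' : r.toNNReal ≤ T := Real.toNNReal_le_iff_le_coe.2 hr.2
  have h1 : ((T : ℝ) - r).toNNReal = T - r.toNNReal := by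
    apply NNReal.eq
    rw [Real.coe_toNNReal _ (sub_nonneg.2 hr.2), NNReal.coe_sub hr', Real.coe_toNNReal _ hr.1]
  rw [vectorField_apply, h1, revDriver_tsub U hr', neg_div]

/-- **The backward Loewner equation** at positive times: `∂ᵣ hᵣ(w) = -2/(hᵣ(w) - U r)`.
Rohde–Schramm (2005), §3.1; Lawler (2005), Rem. 4.8. [cite: RohdeSchramm2005, Lemma 3.1] -/
theorem hasDerivAt_bwdPath (hU : Continuous U) (hw : 0 < w.im) {r : ℝ} (hr : 0 < r) :
    HasDerivAt (bwdPath U w) (-2 / (bwdPath U w r - U r.toNNReal)) r := by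
  set T : ℝ≥0 := r.toNNReal + 1 with hT
  have hrT : r < (T : ℝ) := by
    rw [hT, NNReal.coe_add, Real.coe_toNNReal _ hr.le, NNReal.coe_one]
    linarith
  have hmem : r ∈ Icc (0 : ℝ) T := ⟨hr.le, hrT.le⟩
  have hd := hasDerivWithinAt_bwd (continuous_revDriver hU T) T hw r hmem
  have heq := eqOn_bwdPath_bwd hU hw T
  have hd' : HasDerivWithinAt (bwdPath U w) (-2 / (bwdPath U w r - U r.toNNReal)) (Icc (0 : ℝ) T) r := by
    rw [heq hmem, ← neg_vectorField_revDriver hmem]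
    exact hd.congr heq (heq hmem)
  exact hd'.hasDerivAt (Icc_mem_nhds hr hrT)

/-- The backward Loewner equation at time `0`, as a right derivative. [folklore] -/
theorem hasDerivWithinAt_bwdPath_zero (hU : Continuous U) (hw : 0 < w.im) :
    HasDerivWithinAt (bwdPath U w) (-2 / (w - U 0)) (Ici (0 : ℝ)) 0 := by
  have hmem : (0 : ℝ) ∈ Icc (0 : ℝ) (1 : ℝ≥0) := ⟨le_rfl, by simp⟩
  have hd := hasDerivWithinAt_bwd (continuous_revDriver hU 1) 1 hw 0 hmem
  have heq := eqOn_bwdPath_bwd hU hw 1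
  have h0 : bwdPath U w 0 = w := by
    rw [bwdPath_apply, Real.toNNReal_zero, bwdFlow_zero hU hw]
  have hd' : HasDerivWithinAt (bwdPath U w) (-2 / (w - U 0)) (Icc (0 : ℝ) (1 : ℝ≥0)) 0 := by
    have h1 := hd.congr heq (heq hmem)
    rw [neg_vectorField_revDriver hmem, ← heq hmem, h0, Real.toNNReal_zero] at h1
    exact h1
  exact hd'.mono_of_mem_nhdsWithin (Icc_mem_nhdsGE (by simp))

/-- `bwdPath` is frozen at `w` at non-positive times. [folklore] -/
theorem bwdPath_of_nonpos (hU : Continuous U) (hw : 0 < w.im) {r : ℝ} (hr : r ≤ 0) :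
    bwdPath U w r = w := by
  rw [bwdPath_apply, Real.toNNReal_of_nonpos hr, bwdFlow_zero hU hw]

/-- The backward trajectory is continuous (in real time). [folklore] -/
theorem continuous_bwdPath (hU : Continuous U) (hw : 0 < w.im) : Continuous (bwdPath U w) := by
  rw [continuous_iff_continuousAt]
  intro r
  rcases lt_trichotomy r 0 with hr | rfl | hr
  · -- locally constant
    refine (continuousAt_const (y := w)).congr ?_
    filter_upwards [Iio_mem_nhds hr] with s hs using (bwdPath_of_nonpos hU hw (le_of_lt hs)).symm
  · -- right derivative and left constancy at `0`
    rw [← continuousWithinAt_univ, ← Iic_union_Ici (a := (0 : ℝ)), continuousWithinAt_union]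
    constructor
    · refine (continuousAt_const (y := w)).continuousWithinAt.congr (fun s hs ↦ ?_) ?_
      · exact bwdPath_of_nonpos hU hw hs
      · exact bwdPath_of_nonpos hU hw le_rfl
    · exact (hasDerivWithinAt_bwdPath_zero hU hw).continuousWithinAt
  · exact (hasDerivAt_bwdPath hU hw hr).continuousAt

/-- The backward flow `t ↦ hₜ(w)` is continuous on `ℝ≥0`. [folklore] -/
theorem continuous_bwdFlow (hU : Continuous U) (hw : 0 < w.im) : Continuous (bwdFlow U w) := by
  have : bwdFlow U w = bwdPath U w ∘ ((↑) : ℝ≥0 → ℝ) := by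
    funext t; simp
  rw [this]
  exact (continuous_bwdPath hU hw).comp NNReal.continuous_coe


/-! ### The centred flow `Zₜ = hₜ(w) - U t` and the integrated equations -/

/-- Rohde–Schramm's **centred backward flow** `Zₜ = Xₜ + i Yₜ := hₜ(w) - U t` (§3.1:
`z(t) = g₋ₜ(ẑ) - ξ(-t)`). [cite: RohdeSchramm2005, Thm 3.2] -/
def bwdCentred (U : ℝ≥0 → ℝ) (w : ℂ) (t : ℝ≥0) : ℂ := bwdFlow U w t - U t

/-- Unfolding lemma for `bwdCentred`. [folklore] -/
theorem bwdCentred_apply (U : ℝ≥0 → ℝ) (w : ℂ) (t : ℝ≥0) :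
    bwdCentred U w t = bwdFlow U w t - U t := rfl

/-- `im Zₜ = im hₜ(w)`. [folklore] -/
@[simp] theorem im_bwdCentred (U : ℝ≥0 → ℝ) (w : ℂ) (t : ℝ≥0) :
    (bwdCentred U w t).im = (bwdFlow U w t).im := by
  simp [bwdCentred_apply]

/-- `re Zₜ = re hₜ(w) - U t`. [folklore] -/
theorem re_bwdCentred (U : ℝ≥0 → ℝ) (w : ℂ) (t : ℝ≥0) :
    (bwdCentred U w t).re = (bwdFlow U w t).re - U t := by
  simp [bwdCentred_apply]

/-- `Z₀ = w - U 0`. [folklore] -/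
theorem bwdCentred_zero (hU : Continuous U) (hw : 0 < w.im) : bwdCentred U w 0 = w - U 0 := by
  rw [bwdCentred_apply, bwdFlow_zero hU hw]

/-- `im Zₜ > 0`. [folklore] -/
theorem im_bwdCentred_pos (hU : Continuous U) (hw : 0 < w.im) (t : ℝ≥0) : 0 < (bwdCentred U w t).im := by
  rw [im_bwdCentred]; exact im_bwdFlow_pos hU hw t

/-- `Zₜ ≠ 0`. [folklore] -/
theorem bwdCentred_ne_zero (hU : Continuous U) (hw : 0 < w.im) (t : ℝ≥0) : bwdCentred U w t ≠ 0 :=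
  fun h ↦ (im_bwdCentred_pos hU hw t).ne' (by rw [h, zero_im])

/-- `im w ≤ ‖Zₜ‖`. [folklore] -/
theorem im_le_norm_bwdCentred (hU : Continuous U) (hw : 0 < w.im) (t : ℝ≥0) : w.im ≤ ‖bwdCentred U w t‖ :=
  ((im_le_im_bwdFlow hU hw t).trans_eq (im_bwdCentred U w t).symm).trans (Complex.im_le_norm _)

/-- `‖Zₜ‖ > 0`. [folklore] -/
theorem norm_bwdCentred_pos (hU : Continuous U) (hw : 0 < w.im) (t : ℝ≥0) : 0 < ‖bwdCentred U w t‖ :=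
  norm_pos_iff.2 (bwdCentred_ne_zero hU hw t)

/-- The centred flow is continuous in time. [folklore] -/
theorem continuous_bwdCentred (hU : Continuous U) (hw : 0 < w.im) : Continuous (bwdCentred U w) :=
  (continuous_bwdFlow hU hw).sub (Complex.continuous_ofReal.comp hU)

/-- The centred flow in real time, `r ↦ Z_{r⁺}`, is continuous. [folklore] -/
theorem continuous_bwdCentred_toNNReal (hU : Continuous U) (hw : 0 < w.im) :
    Continuous fun r : ℝ ↦ bwdCentred U w r.toNNReal :=
  (continuous_bwdCentred hU hw).comp continuous_real_toNNReal

/-- The backward equation in terms of `Z`: `∂ᵣ hᵣ(w) = -2/Zᵣ` (`r > 0`). [folklore] -/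
theorem hasDerivAt_bwdPath' (hU : Continuous U) (hw : 0 < w.im) {r : ℝ} (hr : 0 < r) :
    HasDerivAt (bwdPath U w) (-2 / bwdCentred U w r.toNNReal) r := by
  have := hasDerivAt_bwdPath hU hw hr
  rwa [bwdPath_apply, ← bwdCentred_apply] at this

/-- `Re (-2/Z) = -(2 Re Z/‖Z‖²)`. [folklore] -/
theorem re_neg_two_div (Z : ℂ) : (-2 / Z).re = -(2 * Z.re / ‖Z‖ ^ 2) := by
  rw [div_re, ← normSq_eq_norm_sq]
  simp
  ring

/-- `Im (-2/Z) = 2 Im Z/‖Z‖²`. [folklore] -/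
theorem im_neg_two_div (Z : ℂ) : (-2 / Z).im = 2 * Z.im / ‖Z‖ ^ 2 := by
  rw [div_im, ← normSq_eq_norm_sq]
  simp
  ring

/-- `∂ᵣ re hᵣ(w) = -2 Xᵣ/‖Zᵣ‖²` (`r > 0`). [folklore] -/
theorem hasDerivAt_re_bwdPath (hU : Continuous U) (hw : 0 < w.im) {r : ℝ} (hr : 0 < r) :
    HasDerivAt (fun r ↦ (bwdPath U w r).re)
      (-(2 * (bwdCentred U w r.toNNReal).re / ‖bwdCentred U w r.toNNReal‖ ^ 2)) r := by
  have h := (Complex.reCLM : ℂ →L[ℝ] ℝ).hasFDerivAt.comp_hasDerivAt r (hasDerivAt_bwdPath' hU hw hr)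
  rw [Complex.reCLM_apply, re_neg_two_div] at h
  exact h

/-- `∂ᵣ im hᵣ(w) = 2 Yᵣ/‖Zᵣ‖²` (`r > 0`). [folklore] -/
theorem hasDerivAt_im_bwdPath (hU : Continuous U) (hw : 0 < w.im) {r : ℝ} (hr : 0 < r) :
    HasDerivAt (fun r ↦ (bwdPath U w r).im)
      (2 * (bwdCentred U w r.toNNReal).im / ‖bwdCentred U w r.toNNReal‖ ^ 2) r := by
  have h := (Complex.imCLM : ℂ →L[ℝ] ℝ).hasFDerivAt.comp_hasDerivAt r (hasDerivAt_bwdPath' hU hw hr)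
  rw [Complex.imCLM_apply, im_neg_two_div] at h
  exact h

/-- **`re hₜ(w) = re w - ∫₀ᵗ 2Xₛ/‖Zₛ‖² ds`** (the real part of the backward equation, integrated):
the finite-variation part of `dXₜ = -(2Xₜ/|Zₜ|²) dt - dUₜ`. Rohde–Schramm (2005), (3.11)
(`dx = 2x dt/(x² + y²) - dξ` in forward time). [cite: RohdeSchramm2005, Thm 3.2 (proof, (3.11))] -/
theorem re_bwdFlow_eq (hU : Continuous U) (hw : 0 < w.im) (t : ℝ≥0) :
    (bwdFlow U w t).re = w.re -
      ∫ s in (0 : ℝ)..t, 2 * (bwdCentred U w s.toNNReal).re / ‖bwdCentred U w s.toNNReal‖ ^ 2 := by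
  set G : ℝ → ℝ := fun r ↦ (bwdPath U w r).re with hG
  set G' : ℝ → ℝ := fun r ↦ -(2 * (bwdCentred U w r.toNNReal).re / ‖bwdCentred U w r.toNNReal‖ ^ 2)
    with hG'
  have hZc := continuous_bwdCentred_toNNReal hU hw
  have hcont : ContinuousOn G (Icc 0 t) :=
    (Complex.continuous_re.comp (continuous_bwdPath hU hw)).continuousOn
  have hderiv : ∀ r ∈ Ioo (0 : ℝ) t, HasDerivAt G (G' r) r := fun r hr ↦
    hasDerivAt_re_bwdPath hU hw hr.1
  have hcont' : Continuous G' :=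
    ((continuous_const.mul (Complex.continuous_re.comp hZc)).div (hZc.norm.pow 2)
      fun r ↦ pow_ne_zero 2 (norm_bwdCentred_pos hU hw _).ne').neg
  have hFTC := integral_eq_sub_of_hasDerivAt_of_le (NNReal.coe_nonneg t) hcont hderiv
    (hcont'.intervalIntegrable _ _)
  have hG0 : G 0 = w.re := by
    simp only [hG]; rw [bwdPath_of_nonpos hU hw le_rfl]
  have hGt : G t = (bwdFlow U w t).re := by simp only [hG, bwdPath_coe]
  rw [hG0, hGt] at hFTC
  simp only [hG', intervalIntegral.integral_neg] at hFTC
  linarith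

/-- **`Yₜ = im w + ∫₀ᵗ 2Yₛ/‖Zₛ‖² ds`** (`Y` is `C¹` and non-decreasing). Rohde–Schramm (2005),
(3.11) (`dy = -2y dt/(x² + y²)` in forward time). [cite: RohdeSchramm2005, Thm 3.2 (proof, (3.11))] -/
theorem im_bwdFlow_eq (hU : Continuous U) (hw : 0 < w.im) (t : ℝ≥0) :
    (bwdFlow U w t).im = w.im +
      ∫ s in (0 : ℝ)..t, 2 * (bwdCentred U w s.toNNReal).im / ‖bwdCentred U w s.toNNReal‖ ^ 2 := by
  set G : ℝ → ℝ := fun r ↦ (bwdPath U w r).im with hG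
  set G' : ℝ → ℝ := fun r ↦ 2 * (bwdCentred U w r.toNNReal).im / ‖bwdCentred U w r.toNNReal‖ ^ 2
    with hG'
  have hZc := continuous_bwdCentred_toNNReal hU hw
  have hcont : ContinuousOn G (Icc 0 t) :=
    (Complex.continuous_im.comp (continuous_bwdPath hU hw)).continuousOn
  have hderiv : ∀ r ∈ Ioo (0 : ℝ) t, HasDerivAt G (G' r) r := fun r hr ↦
    hasDerivAt_im_bwdPath hU hw hr.1
  have hcont' : Continuous G' :=
    (continuous_const.mul (Complex.continuous_im.comp hZc)).div (hZc.norm.pow 2)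
      fun r ↦ pow_ne_zero 2 (norm_bwdCentred_pos hU hw _).ne'
  have hFTC := integral_eq_sub_of_hasDerivAt_of_le (NNReal.coe_nonneg t) hcont hderiv
    (hcont'.intervalIntegrable _ _)
  have hG0 : G 0 = w.im := by
    simp only [hG]; rw [bwdPath_of_nonpos hU hw le_rfl]
  have hGt : G t = (bwdFlow U w t).im := by simp only [hG, bwdPath_coe]
  rw [hG0, hGt] at hFTC
  simp only [hG'] at hFTC
  linarith

/-- **`log Yₜ = log (im w) + ∫₀ᵗ 2/‖Zₛ‖² ds`** (`∂ log Y = 2/|Z|²`; Rohde–Schramm's time change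
`u = log y`, eq. (3.9): `∂ₜ u = -2|z|⁻²` in forward time). [cite: RohdeSchramm2005, eq. (3.9)] -/
theorem log_im_bwdFlow_eq (hU : Continuous U) (hw : 0 < w.im) (t : ℝ≥0) :
    Real.log (bwdFlow U w t).im = Real.log w.im +
      ∫ s in (0 : ℝ)..t, 2 / ‖bwdCentred U w s.toNNReal‖ ^ 2 := by
  set G : ℝ → ℝ := fun r ↦ Real.log (bwdPath U w r).im with hG
  set G' : ℝ → ℝ := fun r ↦ 2 / ‖bwdCentred U w r.toNNReal‖ ^ 2 with hG'
  have hZc := continuous_bwdCentred_toNNReal hU hw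
  have hpos : ∀ r, 0 < (bwdPath U w r).im := fun r ↦ im_bwdFlow_pos hU hw _
  have hcont : ContinuousOn G (Icc 0 t) :=
    ((Complex.continuous_im.comp (continuous_bwdPath hU hw)).continuousOn).log
      fun r _ ↦ (hpos r).ne'
  have hderiv : ∀ r ∈ Ioo (0 : ℝ) t, HasDerivAt G (G' r) r := by
    intro r hr
    have h1 := (hasDerivAt_im_bwdPath hU hw hr.1).log (hpos r).ne'
    refine h1.congr_deriv ?_
    have hy : (bwdPath U w r).im ≠ 0 := (hpos r).ne'
    have hy' : (bwdCentred U w r.toNNReal).im = (bwdPath U w r).im := by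
      rw [im_bwdCentred, bwdPath_apply]
    simp only [hG', hy']
    field_simp
  have hcont' : Continuous G' :=
    continuous_const.div (hZc.norm.pow 2)
      fun r ↦ pow_ne_zero 2 (norm_bwdCentred_pos hU hw _).ne'
  have hFTC := integral_eq_sub_of_hasDerivAt_of_le (NNReal.coe_nonneg t) hcont hderiv
    (hcont'.intervalIntegrable _ _)
  have hG0 : G 0 = Real.log w.im := by
    simp only [hG]; rw [bwdPath_of_nonpos hU hw le_rfl]
  have hGt : G t = Real.log (bwdFlow U w t).im := by simp only [hG, bwdPath_coe]
  rw [hG0, hGt] at hFTC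
  simp only [hG'] at hFTC
  linarith

/-- `Y` is non-decreasing along the backward flow. [folklore] -/
theorem monotone_im_bwdFlow (hU : Continuous U) (hw : 0 < w.im) : Monotone fun t ↦ (bwdFlow U w t).im := by
  have hmono : MonotoneOn (fun r ↦ (bwdPath U w r).im) (Ici (0 : ℝ)) := by
    refine monotoneOn_of_hasDerivWithinAt_nonneg (convex_Ici 0)
      ((Complex.continuous_im.comp (continuous_bwdPath hU hw)).continuousOn) (fun r hr ↦ ?_)
      (fun r hr ↦ ?_) (f' := fun r ↦ 2 * (bwdCentred U w r.toNNReal).im / ‖bwdCentred U w r.toNNReal‖ ^ 2)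
    · rw [interior_Ici] at hr
      exact (hasDerivAt_im_bwdPath hU hw hr).hasDerivWithinAt
    · exact div_nonneg (mul_nonneg zero_le_two (im_bwdCentred_pos hU hw _).le) (sq_nonneg _)
  intro s t hst
  have := hmono (s.coe_nonneg) (t.coe_nonneg) (NNReal.coe_le_coe.2 hst)
  simpa using this

/-- **`Yₜ² ≤ (im w)² + 4t`** (`∂(Y²) = 4Y²/|Z|² ≤ 4`): the backward flow rises at most like
`√(4t)`. Rohde–Schramm (2005), proof of Cor. 3.5 ("there is a constant `c` such that `u₁ ≤ c`,
because `t, y ≤ 1`"). [cite: RohdeSchramm2005, Cor 3.5 (proof)] -/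
theorem sq_im_bwdFlow_le (hU : Continuous U) (hw : 0 < w.im) (t : ℝ≥0) :
    (bwdFlow U w t).im ^ 2 ≤ w.im ^ 2 + 4 * t := by
  set F : ℝ → ℝ := fun r ↦ (bwdPath U w r).im ^ 2 - 4 * r with hF
  have hanti : AntitoneOn F (Ici (0 : ℝ)) := by
    refine antitoneOn_of_hasDerivWithinAt_nonpos (convex_Ici 0) ?_ (fun r hr ↦ ?_) (fun r hr ↦ ?_)
      (f' := fun r ↦ 2 * (bwdPath U w r).im *
        (2 * (bwdCentred U w r.toNNReal).im / ‖bwdCentred U w r.toNNReal‖ ^ 2) - 4)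
    · exact (((Complex.continuous_im.comp (continuous_bwdPath hU hw)).pow 2).sub
        (continuous_const.mul continuous_id)).continuousOn
    · rw [interior_Ici] at hr
      have h1 := (hasDerivAt_im_bwdPath hU hw hr).pow 2
      have h2 : HasDerivAt (fun r : ℝ ↦ 4 * r) 4 r := by
        simpa using (hasDerivAt_id r).const_mul (4 : ℝ)
      have h3 := h1.sub h2
      refine (h3.hasDerivWithinAt).congr_deriv ?_
      simp only [Nat.cast_ofNat]
      ring
    · rw [interior_Ici] at hr
      have hy : (bwdCentred U w r.toNNReal).im = (bwdPath U w r).im := by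
        rw [im_bwdCentred, bwdPath_apply]
      have hYpos : 0 < (bwdPath U w r).im := im_bwdFlow_pos hU hw _
      have hYle : (bwdPath U w r).im ≤ ‖bwdCentred U w r.toNNReal‖ := by
        rw [← hy]; exact Complex.im_le_norm _
      have hn : 0 < ‖bwdCentred U w r.toNNReal‖ := norm_bwdCentred_pos hU hw _
      rw [hy, sub_nonpos]
      have hsq : (bwdPath U w r).im ^ 2 ≤ ‖bwdCentred U w r.toNNReal‖ ^ 2 :=
        pow_le_pow_left₀ hYpos.le hYle 2
      rw [show 2 * (bwdPath U w r).im * (2 * (bwdPath U w r).im / ‖bwdCentred U w r.toNNReal‖ ^ 2) =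
        4 * ((bwdPath U w r).im ^ 2 / ‖bwdCentred U w r.toNNReal‖ ^ 2) by ring]
      have : (bwdPath U w r).im ^ 2 / ‖bwdCentred U w r.toNNReal‖ ^ 2 ≤ 1 := by
        rw [div_le_one (by positivity)]; exact hsq
      linarith
  have h := hanti (self_mem_Ici) (t.coe_nonneg : (0 : ℝ) ≤ t) t.coe_nonneg
  simp only [hF, bwdPath_coe, mul_zero, sub_zero] at h
  rw [bwdPath_of_nonpos hU hw le_rfl] at h
  linarith

/-- `im w ≤ Yₛ ≤ Yₜ` for `s ≤ t`, hence `0 < Yₛ`. [folklore] -/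
theorem im_bwdFlow_le_im_bwdFlow (hU : Continuous U) (hw : 0 < w.im) {s t : ℝ≥0} (hst : s ≤ t) :
    (bwdFlow U w s).im ≤ (bwdFlow U w t).im :=
  monotone_im_bwdFlow hU hw hst


/-! ### The derivative in the starting point: `hₜ'(w) = exp ∫₀ᵗ 2/Zₛ² ds` -/

section StartDerivative

variable {W : ℝ≥0 → ℝ} {z : ℂ}

/-- **The derivative of the inverse Loewner map, explicitly**: for a continuous driving function,
`fₜ = gₜ⁻¹` is complex differentiable at every `z ∈ ℍ` with
`fₜ'(z) = exp ∫₀ᵗ 2/(h(u) - W(t-u))² du`, `h = bwd W t z` the backward trajectory from `z`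
(the linearised backward equation `Ḋ = 2D/((h_z - W)(h_{z'} - W))` solved and `z' → z`; this
sharpens the tree's `hasDerivAt_invFunOn_map`, which asserts an unspecified non-zero derivative).
Lawler (2005), Ch. 4 §4.1, eq. (4.7) (`∂ₜ log gₜ' = -2/(gₜ - Uₜ)²`); Rohde–Schramm (2005), (3.9).
[cite: Lawler2005, Ch. 4 §4.1, eq. (4.7)] -/
theorem hasDerivAt_loewnerInv_exp (hW : Continuous W) (t : ℝ≥0) (hz : 0 < z.im) :
    HasDerivAt (loewnerInv W t)
      (exp (∫ u in (0 : ℝ)..t, 2 / (bwd W t z u - W (((t : ℝ) - u).toNNReal)) ^ 2)) z := by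
  set w₀ := z with hw₀def
  have hw₀ : 0 < w₀.im := hz
  set m : ℝ≥0 := ⟨w₀.im / 2, by positivity⟩
  have hm : 0 < m := by
    change (0 : ℝ) < w₀.im / 2
    positivity
  have hm' : (0 : ℝ) < m := hm
  have hmw₀ : (m : ℝ) < w₀.im := by
    change w₀.im / 2 < w₀.im
    linarith
  have hback : ∀ w : ℂ, (m : ℝ) < w.im → ∃ h : ℝ → ℂ, h 0 = w ∧ Continuous h ∧
      (∀ s ∈ Icc (0 : ℝ) t, HasDerivWithinAt h (-vectorField W ((t : ℝ) - s) (h s))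
        (Icc (-1 : ℝ) t) s) ∧
      (∀ s ∈ Icc (0 : ℝ) t, w.im ≤ (h s).im) ∧ h t ∈ domain W t ∧ map W t (h t) = w :=
    fun w hw ↦ exists_backward_solution hW t hm hw
  choose H hH0 hHc hHd hHim hHdom hHmap using hback
  have hHim' : ∀ w (hw : (m : ℝ) < w.im), ∀ s ∈ Icc (0 : ℝ) t, (m : ℝ) ≤ (H w hw s).im :=
    fun w hw s hs ↦ hw.le.trans (hHim w hw s hs)
  -- `fₜ` is given by the backward solutions
  have hF : ∀ w (hw : (m : ℝ) < w.im), loewnerInv W t w = H w hw t := by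
    intro w hw
    have hwH : 0 < w.im := hm'.trans hw
    exact invFunOn_map_eq hW hwH (hHdom w hw) (hHmap w hw)
  -- the backward solution from `w₀` is `bwd W t w₀` on `[0, t]`
  set h₀ := H w₀ hmw₀ with hh₀
  have hh00 : h₀ 0 = w₀ := hH0 w₀ hmw₀
  have hIcc : Icc (0 : ℝ) t ⊆ Icc (-1 : ℝ) t := Icc_subset_Icc_left (by norm_num)
  have heq : EqOn h₀ (bwd W t w₀) (Icc (0 : ℝ) t) :=
    eqOn_bwd hW t hw₀ hh00 fun u hu ↦ (hHd w₀ hmw₀ u hu).mono hIcc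
  set I₀ : ℂ := ∫ u in (0 : ℝ)..t, bwdCoeff W t m h₀ h₀ u with hI₀
  have hI₀eq : I₀ = ∫ u in (0 : ℝ)..t, 2 / (bwd W t w₀ u - W (((t : ℝ) - u).toNNReal)) ^ 2 := by
    refine intervalIntegral.integral_congr fun u hu ↦ ?_
    rw [uIcc_of_le t.coe_nonneg] at hu
    have h1 : liftIm m (h₀ u) = h₀ u := liftIm_of_le (hHim' w₀ hmw₀ u hu)
    simp only [bwdCoeff]
    rw [h1, heq hu, sq]
  rw [← hI₀eq]
  -- the integrals `∫₀ᵗ A_w` as a function of `w`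
  classical
  set G : ℂ → ℂ := fun w ↦ if hw : (m : ℝ) < w.im then
    ∫ u in (0 : ℝ)..t, bwdCoeff W t m (H w hw) h₀ u else I₀ with hG
  set C : ℝ := 2 / m ^ 3 * Real.exp (2 / m ^ 2 * t) * t with hC
  have hGbound : ∀ w, ‖G w - I₀‖ ≤ C * ‖w - w₀‖ := by
    intro w
    by_cases hw : (m : ℝ) < w.im
    · simp only [hG, dif_pos hw, hI₀]
      rw [← intervalIntegral.integral_sub
        ((continuous_bwdCoeff hW hm (hHc w hw) (hHc w₀ hmw₀)).intervalIntegrable _ _)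
        ((continuous_bwdCoeff hW hm (hHc w₀ hmw₀) (hHc w₀ hmw₀)).intervalIntegrable _ _)]
      have hle : ∀ u ∈ Set.uIoc (0 : ℝ) t, ‖bwdCoeff W t m (H w hw) h₀ u - bwdCoeff W t m h₀ h₀ u‖ ≤
          2 / m ^ 3 * Real.exp (2 / m ^ 2 * t) * ‖w - w₀‖ := by
        intro u hu
        rw [Set.uIoc_of_le t.coe_nonneg] at hu
        have hu' : u ∈ Icc (0 : ℝ) t := ⟨hu.1.le, hu.2⟩
        refine (norm_bwdCoeff_sub_le hm (H w hw) h₀ u).trans ?_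
        have hdist := norm_sub_le_mul_exp hW hm (hHc w hw) (hHc w₀ hmw₀) (hHd w hw) (hHd w₀ hmw₀)
          (hHim' w hw) (hHim' w₀ hmw₀) hu'
        simp only [hH0] at hdist
        have hexp : Real.exp (2 / m ^ 2 * u) ≤ Real.exp (2 / m ^ 2 * t) := by
          gcongr; exact hu.2
        calc 2 / (m : ℝ) ^ 3 * ‖H w hw u - h₀ u‖
            ≤ 2 / (m : ℝ) ^ 3 * (‖w - w₀‖ * Real.exp (2 / m ^ 2 * u)) := by gcongr
          _ ≤ 2 / (m : ℝ) ^ 3 * (‖w - w₀‖ * Real.exp (2 / m ^ 2 * t)) := by gcongr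
          _ = 2 / m ^ 3 * Real.exp (2 / m ^ 2 * t) * ‖w - w₀‖ := by ring
      refine (intervalIntegral.norm_integral_le_of_norm_le_const hle).trans ?_
      rw [sub_zero, abs_of_nonneg t.coe_nonneg, hC]
      nlinarith [norm_nonneg (w - w₀), t.coe_nonneg,
        (by positivity : (0 : ℝ) ≤ 2 / m ^ 3 * Real.exp (2 / m ^ 2 * t))]
    · simp only [hG, dif_neg hw, sub_self, norm_zero]
      positivity
  have hGt : Tendsto G (𝓝 w₀) (𝓝 I₀) := by
    rw [tendsto_iff_norm_sub_tendsto_zero]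
    refine squeeze_zero (fun w ↦ norm_nonneg _) hGbound ?_
    have : Tendsto (fun w : ℂ ↦ C * ‖w - w₀‖) (𝓝 w₀) (𝓝 (C * ‖w₀ - w₀‖)) :=
      tendsto_const_nhds.mul (continuous_norm.continuousAt.tendsto.comp
        (tendsto_id.sub tendsto_const_nhds))
    simpa using this
  have hexpG : Tendsto (fun w ↦ exp (G w)) (𝓝[≠] w₀) (𝓝 (exp I₀)) :=
    ((continuous_exp.continuousAt.tendsto).comp hGt).mono_left nhdsWithin_le_nhds
  rw [hasDerivAt_iff_tendsto_slope]
  refine hexpG.congr' ?_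
  have hopen : {w : ℂ | (m : ℝ) < w.im} ∈ 𝓝 w₀ :=
    (isOpen_lt continuous_const Complex.continuous_im).mem_nhds hmw₀
  filter_upwards [mem_nhdsWithin_of_mem_nhds hopen, self_mem_nhdsWithin] with w hw hne
  have hw : (m : ℝ) < w.im := hw
  have hne : w ≠ w₀ := hne
  simp only [hG, dif_pos hw]
  rw [slope_def_field, hF w hw, hF w₀ hmw₀, ← hh₀]
  have key := sub_eq_mul_exp_integral hW hm (hHc w hw) (hHc w₀ hmw₀) (hHd w hw) (hHd w₀ hmw₀)
    (hHim' w hw) (hHim' w₀ hmw₀) (s := t) ⟨t.coe_nonneg, le_rfl⟩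
  simp only [hH0] at key
  rw [key, ← hh₀, mul_div_cancel_left₀ _ (sub_ne_zero.2 hne)]

/-- The derivative of `fₜ` at `z ∈ ℍ`, as a formula for `deriv`. [cite: Lawler2005, Ch. 4 §4.1, eq. (4.7)] -/
theorem deriv_loewnerInv_eq_exp (hW : Continuous W) (t : ℝ≥0) (hz : 0 < z.im) :
    deriv (loewnerInv W t) z =
      exp (∫ u in (0 : ℝ)..t, 2 / (bwd W t z u - W (((t : ℝ) - u).toNNReal)) ^ 2) :=
  (hasDerivAt_loewnerInv_exp hW t hz).deriv

end StartDerivative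

/-- The integrand of the derivative formula, read along the backward flow: for `0 ≤ u ≤ t`,
`bwd (revDriver U t) t w u - revDriver U t (t - u) = Z_u`. [folklore] -/
theorem bwd_revDriver_sub_eq {t : ℝ≥0} (hU : Continuous U) (hw : 0 < w.im) {u : ℝ}
    (hu : u ∈ Icc (0 : ℝ) t) :
    bwd (revDriver U t) t w u - revDriver U t (((t : ℝ) - u).toNNReal) = bwdCentred U w u.toNNReal := by
  have hu' : u.toNNReal ≤ t := Real.toNNReal_le_iff_le_coe.2 hu.2
  have h1 : ((t : ℝ) - u).toNNReal = t - u.toNNReal := by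
    apply NNReal.eq
    rw [Real.coe_toNNReal _ (sub_nonneg.2 hu.2), NNReal.coe_sub hu', Real.coe_toNNReal _ hu.1]
  rw [← eqOn_bwdPath_bwd hU hw t hu, h1, revDriver_tsub U hu', bwdPath_apply, bwdCentred_apply]

/-- **`w ↦ hₜ(w)` is holomorphic on `ℍ` with `hₜ'(w) = exp ∫₀ᵗ 2/Zₛ² ds`**, `Zₛ = hₛ(w) - U s`
(Rohde–Schramm's (3.9), `∂ₜ log |gₜ'(z)| = -2 Re((gₜ(z) - ξ(t))⁻²)`, for the backward flow the
sign flips). [cite: RohdeSchramm2005, eq. (3.9)] -/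
theorem hasDerivAt_bwdFlow_start (hU : Continuous U) (t : ℝ≥0) (hw : 0 < w.im) :
    HasDerivAt (fun w ↦ bwdFlow U w t)
      (exp (∫ u in (0 : ℝ)..t, 2 / (bwdCentred U w u.toNNReal) ^ 2)) w := by
  have h := hasDerivAt_loewnerInv_exp (continuous_revDriver hU t) t hw
  have hI : ∫ u in (0 : ℝ)..t, 2 / (bwd (revDriver U t) t w u - revDriver U t (((t : ℝ) - u).toNNReal)) ^ 2 =
      ∫ u in (0 : ℝ)..t, 2 / (bwdCentred U w u.toNNReal) ^ 2 := by
    refine intervalIntegral.integral_congr fun u hu ↦ ?_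
    rw [uIcc_of_le t.coe_nonneg] at hu
    simp only [bwd_revDriver_sub_eq hU hw hu]
  rw [hI] at h
  exact h

/-- `hₜ'(w) = exp ∫₀ᵗ 2/Zₛ² ds` as a formula for `deriv`. [cite: RohdeSchramm2005, eq. (3.9)] -/
theorem deriv_bwdFlow_start_eq (hU : Continuous U) (t : ℝ≥0) (hw : 0 < w.im) :
    deriv (fun w ↦ bwdFlow U w t) w = exp (∫ u in (0 : ℝ)..t, 2 / (bwdCentred U w u.toNNReal) ^ 2) :=
  (hasDerivAt_bwdFlow_start hU t hw).deriv

/-- `w ↦ hₜ(w)` is complex differentiable at every point of `ℍ`. [folklore] -/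
theorem differentiableAt_bwdFlow_start (hU : Continuous U) (t : ℝ≥0) (hw : 0 < w.im) :
    DifferentiableAt ℂ (fun w ↦ bwdFlow U w t) w :=
  (hasDerivAt_bwdFlow_start hU t hw).differentiableAt

/-- `hₜ'(w) ≠ 0`. [folklore] -/
theorem deriv_bwdFlow_start_ne_zero (hU : Continuous U) (t : ℝ≥0) (hw : 0 < w.im) :
    deriv (fun w ↦ bwdFlow U w t) w ≠ 0 := by
  rw [deriv_bwdFlow_start_eq hU t hw]; exact exp_ne_zero _


/-! ### `|hₜ'(w)|`, `log Yₜ` and Rohde–Schramm's `ψ` along the backward flow -/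

/-- The rate of `log |hₜ'(w)|`: `Re (2/Zᵤ²) = 2(Xᵤ² - Yᵤ²)/‖Zᵤ‖⁴` (Rohde–Schramm's (3.9) for the
backward flow). [cite: RohdeSchramm2005, eq. (3.9)] -/
def bwdLogDerivRate (U : ℝ≥0 → ℝ) (w : ℂ) (u : ℝ) : ℝ :=
  (2 / (bwdCentred U w u.toNNReal) ^ 2).re

/-- The rate of `log Yᵤ`: `2/‖Zᵤ‖²` (Rohde–Schramm's `∂ₜu = -2|z|⁻²`, eq. (3.9), sign reversed).
[cite: RohdeSchramm2005, eq. (3.9)] -/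
def bwdLogImRate (U : ℝ≥0 → ℝ) (w : ℂ) (u : ℝ) : ℝ :=
  2 / ‖bwdCentred U w u.toNNReal‖ ^ 2

/-- The rate of `-log ψᵤ`: `4Yᵤ²/‖Zᵤ‖⁴` (Rohde–Schramm's (3.11): `d log ψ = 4y² dt/(x² + y²)²`).
[cite: RohdeSchramm2005, Thm 3.2 (proof, (3.11))] -/
def bwdPsiRate (U : ℝ≥0 → ℝ) (w : ℂ) (u : ℝ) : ℝ :=
  4 * (bwdCentred U w u.toNNReal).im ^ 2 / ‖bwdCentred U w u.toNNReal‖ ^ 4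

/-- Unfolding lemma for `bwdLogDerivRate`. [folklore] -/
theorem bwdLogDerivRate_apply (U : ℝ≥0 → ℝ) (w : ℂ) (u : ℝ) :
    bwdLogDerivRate U w u = (2 / (bwdCentred U w u.toNNReal) ^ 2).re := rfl

/-- Unfolding lemma for `bwdLogImRate`. [folklore] -/
theorem bwdLogImRate_apply (U : ℝ≥0 → ℝ) (w : ℂ) (u : ℝ) :
    bwdLogImRate U w u = 2 / ‖bwdCentred U w u.toNNReal‖ ^ 2 := rfl

/-- Unfolding lemma for `bwdPsiRate`. [folklore] -/
theorem bwdPsiRate_apply (U : ℝ≥0 → ℝ) (w : ℂ) (u : ℝ) :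
    bwdPsiRate U w u = 4 * (bwdCentred U w u.toNNReal).im ^ 2 / ‖bwdCentred U w u.toNNReal‖ ^ 4 := rfl

/-- `Re (2/Z²) = 2 (Re Z² - Im Z²)/‖Z‖⁴`. [folklore] -/
theorem re_two_div_sq (Z : ℂ) : (2 / Z ^ 2).re = 2 * (Z.re ^ 2 - Z.im ^ 2) / ‖Z‖ ^ 4 := by
  rw [div_re, normSq_eq_norm_sq, Complex.norm_pow]
  simp [sq, mul_re]
  ring

/-- **`Re (2/Z²) = 2/‖Z‖² - 4 (Im Z)²/‖Z‖⁴`**: the rate of `log |h'|` is the rate of `log Y` minus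
the rate of `-log ψ`. [folklore] -/
theorem bwdLogDerivRate_eq_sub (hU : Continuous U) (hw : 0 < w.im) (u : ℝ) :
    bwdLogDerivRate U w u = bwdLogImRate U w u - bwdPsiRate U w u := by
  rw [bwdLogDerivRate_apply, bwdLogImRate_apply, bwdPsiRate_apply, re_two_div_sq]
  set Z := bwdCentred U w u.toNNReal
  have hn : ‖Z‖ ≠ 0 := (norm_bwdCentred_pos hU hw _).ne'
  have hsq : Z.re ^ 2 + Z.im ^ 2 = ‖Z‖ ^ 2 := by
    rw [← normSq_eq_norm_sq, normSq_apply]; ring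
  field_simp
  nlinarith [hsq]

/-- `|Re (2/Z²)| ≤ 2/‖Z‖²`: **`|∂ log |h'|| ≤ ∂ log Y`** (Rohde–Schramm's (3.10)/(3.17):
`|∂ᵤ log |g'ₜ(z)|| ≤ 1` in the time `u = log y`). [cite: RohdeSchramm2005, eq. (3.17)] -/
theorem abs_bwdLogDerivRate_le (hU : Continuous U) (hw : 0 < w.im) (u : ℝ) :
    |bwdLogDerivRate U w u| ≤ bwdLogImRate U w u := by
  rw [bwdLogDerivRate_apply, bwdLogImRate_apply, re_two_div_sq]
  set Z := bwdCentred U w u.toNNReal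
  have hn : 0 < ‖Z‖ := norm_bwdCentred_pos hU hw _
  have hsq : Z.re ^ 2 + Z.im ^ 2 = ‖Z‖ ^ 2 := by
    rw [← normSq_eq_norm_sq, normSq_apply]; ring
  have h4 : ‖Z‖ ^ 4 = ‖Z‖ ^ 2 * ‖Z‖ ^ 2 := by ring
  rw [abs_div, abs_of_pos (by positivity : (0 : ℝ) < ‖Z‖ ^ 4), div_le_div_iff₀ (by positivity)
    (by positivity), abs_mul, abs_of_pos (zero_lt_two' ℝ)]
  have habs : |Z.re ^ 2 - Z.im ^ 2| ≤ ‖Z‖ ^ 2 := by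
    rw [← hsq]
    exact abs_sub_le_of_nonneg_of_le (sq_nonneg _) (le_add_of_nonneg_right (sq_nonneg _))
      (sq_nonneg _) (le_add_of_nonneg_left (sq_nonneg _))
  calc 2 * |Z.re ^ 2 - Z.im ^ 2| * ‖Z‖ ^ 2 ≤ 2 * ‖Z‖ ^ 2 * ‖Z‖ ^ 2 := by gcongr
    _ = 2 * ‖Z‖ ^ 4 := by ring

/-- The `ψ`-rate is non-negative. [folklore] -/
theorem bwdPsiRate_nonneg (U : ℝ≥0 → ℝ) (w : ℂ) (u : ℝ) : 0 ≤ bwdPsiRate U w u := by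
  rw [bwdPsiRate_apply]; positivity

/-- The `ψ`-rate is at most `4/‖Z‖² ≤ 4/(im w)²`. [folklore] -/
theorem bwdPsiRate_le (hU : Continuous U) (hw : 0 < w.im) (u : ℝ) : bwdPsiRate U w u ≤ 4 / w.im ^ 2 := by
  rw [bwdPsiRate_apply]
  set Z := bwdCentred U w u.toNNReal
  have hn : 0 < ‖Z‖ := norm_bwdCentred_pos hU hw _
  have hyZ : w.im ≤ ‖Z‖ := im_le_norm_bwdCentred hU hw _
  have him : Z.im ^ 2 ≤ ‖Z‖ ^ 2 := by
    have := Complex.abs_im_le_norm Z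
    nlinarith [abs_nonneg Z.im, sq_abs Z.im]
  have h1 : 4 * Z.im ^ 2 / ‖Z‖ ^ 4 ≤ 4 / ‖Z‖ ^ 2 := by
    rw [div_le_div_iff₀ (by positivity) (by positivity)]
    nlinarith [him, pow_pos hn 2]
  exact h1.trans (div_le_div_of_nonneg_left (by norm_num) (by positivity) (pow_le_pow_left₀ hw.le hyZ 2))

/-- The rate of `log Y` is positive and at most `2/(im w)²`. [folklore] -/
theorem bwdLogImRate_pos (hU : Continuous U) (hw : 0 < w.im) (u : ℝ) : 0 < bwdLogImRate U w u := by
  rw [bwdLogImRate_apply]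
  exact div_pos two_pos (pow_pos (norm_bwdCentred_pos hU hw _) 2)

/-- `2/‖Z‖² ≤ 2/(im w)²`. [folklore] -/
theorem bwdLogImRate_le (hU : Continuous U) (hw : 0 < w.im) (u : ℝ) : bwdLogImRate U w u ≤ 2 / w.im ^ 2 := by
  rw [bwdLogImRate_apply]
  exact div_le_div_of_nonneg_left zero_le_two (by positivity)
    (pow_le_pow_left₀ hw.le (im_le_norm_bwdCentred hU hw _) 2)

/-- The three rates are continuous in time. [folklore] -/
theorem continuous_bwdLogDerivRate (hU : Continuous U) (hw : 0 < w.im) : Continuous (bwdLogDerivRate U w) := by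
  have hZc := continuous_bwdCentred_toNNReal hU hw
  exact Complex.continuous_re.comp (continuous_const.div (hZc.pow 2)
    fun u ↦ pow_ne_zero 2 (bwdCentred_ne_zero hU hw _))

/-- Continuity of the rate of `log Y`. [folklore] -/
theorem continuous_bwdLogImRate (hU : Continuous U) (hw : 0 < w.im) : Continuous (bwdLogImRate U w) := by
  have hZc := continuous_bwdCentred_toNNReal hU hw
  exact continuous_const.div (hZc.norm.pow 2) fun u ↦ pow_ne_zero 2 (norm_bwdCentred_pos hU hw _).ne'

/-- Continuity of the `ψ`-rate. [folklore] -/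
theorem continuous_bwdPsiRate (hU : Continuous U) (hw : 0 < w.im) : Continuous (bwdPsiRate U w) := by
  have hZc := continuous_bwdCentred_toNNReal hU hw
  exact (continuous_const.mul ((Complex.continuous_im.comp hZc).pow 2)).div (hZc.norm.pow 4)
    fun u ↦ pow_ne_zero 4 (norm_bwdCentred_pos hU hw _).ne'

/-- **`log |hₜ'(w)| = ∫₀ᵗ Re(2/Zᵤ²) du`.** [cite: RohdeSchramm2005, eq. (3.9)] -/
theorem log_norm_deriv_bwdFlow_start (hU : Continuous U) (t : ℝ≥0) (hw : 0 < w.im) :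
    Real.log ‖deriv (fun w ↦ bwdFlow U w t) w‖ = ∫ u in (0 : ℝ)..t, bwdLogDerivRate U w u := by
  rw [deriv_bwdFlow_start_eq hU t hw, Complex.norm_exp, Real.log_exp]
  have hc : Continuous fun u : ℝ ↦ (2 : ℂ) / (bwdCentred U w u.toNNReal) ^ 2 :=
    continuous_const.div ((continuous_bwdCentred_toNNReal hU hw).pow 2)
      fun u ↦ pow_ne_zero 2 (bwdCentred_ne_zero hU hw _)
  have h := Complex.reCLM.intervalIntegral_comp_comm (μ := MeasureTheory.volume) (hc.intervalIntegrable 0 t)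
  simp only [Complex.reCLM_apply] at h
  rw [← h]
  rfl

/-- **`|hₜ'(w)| = exp ∫₀ᵗ Re(2/Zᵤ²) du`.** [cite: RohdeSchramm2005, eq. (3.9)] -/
theorem norm_deriv_bwdFlow_start_eq (hU : Continuous U) (t : ℝ≥0) (hw : 0 < w.im) :
    ‖deriv (fun w ↦ bwdFlow U w t) w‖ = Real.exp (∫ u in (0 : ℝ)..t, bwdLogDerivRate U w u) := by
  rw [← log_norm_deriv_bwdFlow_start hU t hw, Real.exp_log]
  exact norm_pos_iff.2 (deriv_bwdFlow_start_ne_zero hU t hw)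

/-- `log Yₜ = log (im w) + ∫₀ᵗ 2/‖Zᵤ‖² du`, in terms of `bwdLogImRate`. [cite: RohdeSchramm2005, eq. (3.9)] -/
theorem log_im_bwdFlow_eq' (hU : Continuous U) (hw : 0 < w.im) (t : ℝ≥0) :
    Real.log (bwdFlow U w t).im = Real.log w.im + ∫ u in (0 : ℝ)..t, bwdLogImRate U w u :=
  log_im_bwdFlow_eq hU hw t

/-- `Yₜ = im w · exp ∫₀ᵗ 2/‖Zᵤ‖² du`. [folklore] -/
theorem im_bwdFlow_eq_mul_exp (hU : Continuous U) (hw : 0 < w.im) (t : ℝ≥0) :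
    (bwdFlow U w t).im = w.im * Real.exp (∫ u in (0 : ℝ)..t, bwdLogImRate U w u) := by
  have h := log_im_bwdFlow_eq' hU hw t
  have hY : 0 < (bwdFlow U w t).im := im_bwdFlow_pos hU hw t
  calc (bwdFlow U w t).im = Real.exp (Real.log (bwdFlow U w t).im) := (Real.exp_log hY).symm
    _ = w.im * Real.exp (∫ u in (0 : ℝ)..t, bwdLogImRate U w u) := by
        rw [h, Real.exp_add, Real.exp_log hw]

/-- **Rohde–Schramm's `ψ` for the backward flow: `(im w/Yₜ) |hₜ'(w)| = exp(-∫₀ᵗ 4Yᵤ²/‖Zᵤ‖⁴ du)`.**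
(Thm. 3.2: `ψ(u) = ŷ |g'_{T_u}(ẑ)|/y(u)` and `d log ψ = 4y² dt/(x² + y²)²`, here in the original
time of the backward flow.) [cite: RohdeSchramm2005, Thm 3.2 (proof, (3.11))] -/
theorem bwdPsi_eq_exp (hU : Continuous U) (t : ℝ≥0) (hw : 0 < w.im) :
    w.im / (bwdFlow U w t).im * ‖deriv (fun w ↦ bwdFlow U w t) w‖ =
      Real.exp (-∫ u in (0 : ℝ)..t, bwdPsiRate U w u) := by
  rw [norm_deriv_bwdFlow_start_eq hU t hw, im_bwdFlow_eq_mul_exp hU hw t]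
  have hI : ∫ u in (0 : ℝ)..t, bwdLogDerivRate U w u =
      (∫ u in (0 : ℝ)..t, bwdLogImRate U w u) - ∫ u in (0 : ℝ)..t, bwdPsiRate U w u := by
    rw [← intervalIntegral.integral_sub ((continuous_bwdLogImRate hU hw).intervalIntegrable _ _)
      ((continuous_bwdPsiRate hU hw).intervalIntegrable _ _)]
    exact intervalIntegral.integral_congr fun u _ ↦ bwdLogDerivRate_eq_sub hU hw u
  rw [hI, Real.exp_sub, Real.exp_neg]
  have hE : 0 < Real.exp (∫ u in (0 : ℝ)..t, bwdLogImRate U w u) := Real.exp_pos _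
  field_simp

/-- `∫₀ᵗ 4Y²/‖Z‖⁴ ≥ 0`. [folklore] -/
theorem integral_bwdPsiRate_nonneg (U : ℝ≥0 → ℝ) (w : ℂ) (t : ℝ≥0) :
    0 ≤ ∫ u in (0 : ℝ)..t, bwdPsiRate U w u :=
  intervalIntegral.integral_nonneg t.coe_nonneg fun u _ ↦ bwdPsiRate_nonneg U w u

/-- **`ψₜ ≤ 1`**: `(im w/Yₜ) |hₜ'(w)| ≤ 1`. [cite: RohdeSchramm2005, Thm 3.2] -/
theorem bwdPsi_le_one (hU : Continuous U) (t : ℝ≥0) (hw : 0 < w.im) :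
    w.im / (bwdFlow U w t).im * ‖deriv (fun w ↦ bwdFlow U w t) w‖ ≤ 1 := by
  rw [bwdPsi_eq_exp hU t hw, Real.exp_le_one_iff, neg_nonpos]
  exact integral_bwdPsiRate_nonneg U w t

/-- **The Schwarz-lemma step of Cor. 3.5: `|hₜ'(w)| ≤ Yₜ / im w`** ("`y |g'(z)| ≤ Im g(z)` if
`g : ℍ → ℍ`", here from the flow identities). [cite: RohdeSchramm2005, Cor 3.5 (proof)] -/
theorem norm_deriv_bwdFlow_start_le (hU : Continuous U) (t : ℝ≥0) (hw : 0 < w.im) :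
    ‖deriv (fun w ↦ bwdFlow U w t) w‖ ≤ (bwdFlow U w t).im / w.im := by
  have h := bwdPsi_le_one hU t hw
  have hY : 0 < (bwdFlow U w t).im := im_bwdFlow_pos hU hw t
  rw [div_mul_eq_mul_div, div_le_one hY] at h
  rw [le_div_iff₀ hw]
  linarith [mul_comm (w.im) ‖deriv (fun w ↦ bwdFlow U w t) w‖]

/-- **`|log |hₜ'| - log |hₛ'|| ≤ log Yₜ - log Yₛ` for `s ≤ t`** (Rohde–Schramm's (3.17):
`|g'₋ₜ(z)/g'_{T_u}(z)| ≤ exp |u - u₁|`, from `|∂ᵤ log |g'|| ≤ 1`). [cite: RohdeSchramm2005, eq. (3.17)] -/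
theorem abs_log_norm_deriv_sub_le (hU : Continuous U) (hw : 0 < w.im) {s t : ℝ≥0} (hst : s ≤ t) :
    |Real.log ‖deriv (fun w ↦ bwdFlow U w t) w‖ - Real.log ‖deriv (fun w ↦ bwdFlow U w s) w‖| ≤
      Real.log (bwdFlow U w t).im - Real.log (bwdFlow U w s).im := by
  have hst' : (s : ℝ) ≤ t := NNReal.coe_le_coe.2 hst
  have hcr := continuous_bwdLogDerivRate hU hw
  have hci := continuous_bwdLogImRate hU hw
  rw [log_norm_deriv_bwdFlow_start hU t hw, log_norm_deriv_bwdFlow_start hU s hw,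
    log_im_bwdFlow_eq' hU hw t, log_im_bwdFlow_eq' hU hw s, add_sub_add_left_eq_sub,
    intervalIntegral.integral_interval_sub_left (hcr.intervalIntegrable _ _) (hcr.intervalIntegrable _ _),
    intervalIntegral.integral_interval_sub_left (hci.intervalIntegrable _ _) (hci.intervalIntegrable _ _)]
  refine (intervalIntegral.abs_integral_le_integral_abs hst').trans ?_
  exact intervalIntegral.integral_mono_on hst' (hcr.abs.intervalIntegrable _ _) (hci.intervalIntegrable _ _)
    fun u _ ↦ abs_bwdLogDerivRate_le hU hw u

/-- **`|hₜ'(w)| ≤ (Yₜ/Yₛ) |hₛ'(w)|` for `s ≤ t`.** [cite: RohdeSchramm2005, eq. (3.17)] -/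
theorem norm_deriv_bwdFlow_start_le_mul (hU : Continuous U) (hw : 0 < w.im) {s t : ℝ≥0} (hst : s ≤ t) :
    ‖deriv (fun w ↦ bwdFlow U w t) w‖ ≤
      (bwdFlow U w t).im / (bwdFlow U w s).im * ‖deriv (fun w ↦ bwdFlow U w s) w‖ := by
  have h := (abs_le.1 (abs_log_norm_deriv_sub_le hU hw hst)).2
  have hDt : 0 < ‖deriv (fun w ↦ bwdFlow U w t) w‖ := norm_pos_iff.2 (deriv_bwdFlow_start_ne_zero hU t hw)
  have hDs : 0 < ‖deriv (fun w ↦ bwdFlow U w s) w‖ := norm_pos_iff.2 (deriv_bwdFlow_start_ne_zero hU s hw)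
  have hYt : 0 < (bwdFlow U w t).im := im_bwdFlow_pos hU hw t
  have hYs : 0 < (bwdFlow U w s).im := im_bwdFlow_pos hU hw s
  rw [← Real.log_le_log_iff hDt (by positivity), Real.log_mul (by positivity) hDs.ne',
    Real.log_div hYt.ne' hYs.ne']
  linarith

/-- **`|hₛ'(w)| ≤ (Yₜ/Yₛ) |hₜ'(w)|` for `s ≤ t`** (the other half of (3.17)). [cite: RohdeSchramm2005, eq. (3.17)] -/
theorem norm_deriv_bwdFlow_start_le_mul' (hU : Continuous U) (hw : 0 < w.im) {s t : ℝ≥0} (hst : s ≤ t) :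
    ‖deriv (fun w ↦ bwdFlow U w s) w‖ ≤
      (bwdFlow U w t).im / (bwdFlow U w s).im * ‖deriv (fun w ↦ bwdFlow U w t) w‖ := by
  have h := (abs_le.1 (abs_log_norm_deriv_sub_le hU hw hst)).1
  have hDt : 0 < ‖deriv (fun w ↦ bwdFlow U w t) w‖ := norm_pos_iff.2 (deriv_bwdFlow_start_ne_zero hU t hw)
  have hDs : 0 < ‖deriv (fun w ↦ bwdFlow U w s) w‖ := norm_pos_iff.2 (deriv_bwdFlow_start_ne_zero hU s hw)
  have hYt : 0 < (bwdFlow U w t).im := im_bwdFlow_pos hU hw t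
  have hYs : 0 < (bwdFlow U w s).im := im_bwdFlow_pos hU hw s
  rw [← Real.log_le_log_iff hDs (by positivity), Real.log_mul (by positivity) hDt.ne',
    Real.log_div hYt.ne' hYs.ne']
  linarith


end Loewner

end Literature.Probability.RandomPlanarGeometry
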